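import Literature.Computability.AlgebraicComplexity.BILPS19MinrankVarieties
import Literature.NumberTheory.Automorphic.ZariskiCones
import Literature.LinearAlgebra.Matrix.RankMinors
import HarnessLib

/-!
# Bläser–Ikenmeyer–Lysikov–Pandey–Schreyer 2019, Thm 14: minrank varieties are Zariski closed
# (proof of the named fact `BILPS2019_thm14`)

Topic `Literature/Computability/AlgebraicComplexity` (val-lit cell, row BILPS19). Theorems only:
this file discharges the named fact `BILPS2019_thm14` of
`Literature/Computability/AlgebraicComplexity/BILPS19MinrankVarieties.lean` by the theorem
`BILPS2019_thm14_holds`.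

Source: M. Bläser, C. Ikenmeyer, V. Lysikov, A. Pandey, F.-O. Schreyer, *Variety membership
testing, algebraic natural proofs, and geometric complexity theory*, arXiv:1911.02534
[BlaserIkenmeyerLysikovPandeySchreyer2019], Thm 14 (held text `paper:arxiv-1911.02534`,
p0023.txt:L5–27): "Let `U`, `V`, `W` be vector spaces over an algebraically closed field `F`. The
set of all tensors `T ∈ U ⊗ V ⊗ W` with minrank at most `r` is Zariski closed." PRINTED PROOF
(ibid.): the incidence variety `{([T],[x]) ∈ ℙ(U ⊗ V ⊗ W) × ℙU* | rk(Tx) ≤ r}` is projective, its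
image `{[T] | ∃ x ≠ 0 : rk(Tx) ≤ r}` under the first projection is closed "as an image of a
projective variety (see e.g. [Shafarevich1994])", and the affine cone over it is the set in
question.

This file FOLLOWS THE PRINTED PROOF, with the tree's bricks for its two ingredients:

* the main theorem of elimination theory on `k`-points (Shafarevich I.5.2 / Springer 6.1.3), in
  the form `Literature.NumberTheory.Automorphic.isClosed_setOf_exists_common_zero_set`
  (`Literature/NumberTheory/Automorphic/ZariskiCones.lean`, finite case in
  `ProjectiveElimination.lean`): for a set of polynomials `f ∈ F[y][X]` homogeneous in `X`, the
  locus `{y | the f(y,·) have a common zero x ≠ 0}` is closed in the Zariski topology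
  `zariskiTopologyPi` of affine space — applied to the `(r+1) × (r+1)` minors of the generic
  contraction `∑ₐ Xₐ · T_{abc}` (`X`-homogeneous of degree `r+1`), whose common non-zero zeros
  `x` at the parameter `T` are exactly the `x ≠ 0` with `rk(Tx) ≤ r`;
* rank via minors, `Literature.LinearAlgebra.Matrix.rank_le_iff_det_submatrix_eq_zero`
  (`Literature/LinearAlgebra/Matrix/RankMinors.lean`);

(both recorded for `Fin`-indexed tensors, as in the typed fact, and verbatim for arbitrary finite
index types — `BILPS2019Thm14.zariskiClosure_trilinearPt_image_minrankSet` — the form needed on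
`U ⊗ L ⊗ L`, `L = F^{BIdx k' n r}`, by Thm 19 / Cor 20), and a two-line bridge from `IsClosed` in
`zariskiTopologyPi` to the statement's
`zariskiClosure S = S` (`Literature/Computability/AlgebraicComplexity/OrbitClosure.lean`:
`zariskiClosure S = Z(I(S))`). Working directly with the affine cone `{T | ∃ x ≠ 0, rk(Tx) ≤ r}`
and the punctured `x`-space replaces the two projectivisations of the printed proof (the
elimination theorem on `k`-points is already stated for `ℙ(F^k) × 𝔸`).

Honest framing: a published 3-line proof re-assembled over tree lemmas; bookkeeping for the
BILPS minrank programme (Thm 19 / Cor 20 use Thm 14); nothing here bears on `VP ≠ VNP`, which is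
NOT proved.

## References

* [BlaserIkenmeyerLysikovPandeySchreyer2019] M. Bläser, C. Ikenmeyer, V. Lysikov, A. Pandey,
  F.-O. Schreyer, arXiv:1911.02534, Thm 14 and its proof.
* I. R. Shafarevich, *Basic Algebraic Geometry 1*, I.5.2 (main theorem of elimination theory) —
  the reference "[Shafarevich1994]" of the printed proof.
* T. A. Springer, *Linear Algebraic Groups*, 2nd ed., 6.1.3 [SpringerLAG1998] (the tree's source
  for the elimination theorem on points).
-/

noncomputable section

open MvPolynomial Matrix
open scoped Topology

namespace Literature.Computability.AlgebraicComplexity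

namespace BILPS2019Thm14

open Literature.NumberTheory.Automorphic

variable {F : Type*} [Field F]

/-- Bridge between the two Zariski vocabularies of the tree: a subset of affine space closed in
the Zariski topology `zariskiTopologyPi` (i.e. a zero locus `Z(I)`, Springer 1.1.3) is its own
`zariskiClosure` `Z(I(S))` (Mumford, Red book I §2; Springer 1.1.2–1.1.3: the closed sets are the
`V(I)`, and `V(I(V(I))) = V(I)`). The topology is written explicitly
(`IsClosed[zariskiTopologyPi σ F]`), as `zariskiTopologyPi` is not a global instance.
[cite: SpringerLAG1998, 1.1.3] -/
theorem zariskiClosure_eq_self_of_isClosed {σ : Type*} {S : Set (σ → F)}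
    (h : IsClosed[zariskiTopologyPi σ F] S) : zariskiClosure S = S := by
  obtain ⟨I, rfl⟩ := isClosed_iff_exists_zeroLocus.1 h
  exact Set.Subset.antisymm
    (MvPolynomial.zeroLocus_anti_mono (MvPolynomial.le_vanishingIdeal_zeroLocus I))
    (subset_zariskiClosure _)

/-- The determinant of a square matrix of linear forms (in the variables `ι`, any coefficient
ring) is a form of degree the size of the matrix (Leibniz expansion). [folklore] -/
private theorem isHomogeneous_det_of_forall_isHomogeneous_one {R : Type*} [CommRing R] {ι n : Type*}
    [Fintype n] [DecidableEq n] {M : Matrix n n (MvPolynomial ι R)}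
    (h : ∀ i j, (M i j).IsHomogeneous 1) : M.det.IsHomogeneous (Fintype.card n) := by
  rw [Matrix.det_apply]
  refine IsHomogeneous.sum _ _ _ fun τ _ => ?_
  have hp : (∏ i, M (τ i) i).IsHomogeneous (Fintype.card n) := by
    have := IsHomogeneous.prod Finset.univ (fun i => M (τ i) i) (fun _ => 1) fun i _ => h _ _
    simpa using this
  rw [Units.smul_def]
  exact (mem_homogeneousSubmodule _ _).mp
    (zsmul_mem ((mem_homogeneousSubmodule _ _).mpr hp) _)

section Minors

variable (F)

/-- The generic contraction `∑ₐ Xₐ T_{abc}`: an `m × n` matrix of linear forms in the variables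
`X₁, …, X_k` (coordinates of `x ∈ U*`) with coefficients in the coordinate ring
`F[T_{abc}]` of `U ⊗ V ⊗ W` (proof of Thm 14: "`{(T, x) | rk(Tx) ≤ r}`").
[cite: BlaserIkenmeyerLysikovPandeySchreyer2019, Thm. 14 (proof)] -/
theorem genericContract_isHomogeneous (k m n : ℕ) (b : Fin m) (c : Fin n) :
    (∑ a : Fin k, (X a : MvPolynomial (Fin k) (MvPolynomial (Fin k × Fin m × Fin n) F)) *
        C (X (a, b, c))).IsHomogeneous 1 := by
  refine IsHomogeneous.sum _ _ _ fun a _ => ?_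
  simpa using (isHomogeneous_X _ a).mul (isHomogeneous_C (Fin k) (X (a, b, c) :
    MvPolynomial (Fin k × Fin m × Fin n) F))

/-- Specialising the generic contraction at the point `T` of `U ⊗ V ⊗ W` and evaluating at
`x ∈ U*` gives the contraction `Tx` of Def 13; hence the same for its minors.
[cite: BlaserIkenmeyerLysikovPandeySchreyer2019, Thm. 14 (proof)] -/
theorem eval_specialize_det_submatrix (k m n : ℕ) {s : ℕ} (ρ : Fin s → Fin m) (γ : Fin s → Fin n)
    (p : Fin k × Fin m × Fin n → F) (x : Fin k → F) :
    eval x (specialize p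
      ((Matrix.of fun (b : Fin m) (c : Fin n) =>
          ∑ a : Fin k, (X a : MvPolynomial (Fin k) (MvPolynomial (Fin k × Fin m × Fin n) F)) *
            C (X (a, b, c))).submatrix ρ γ).det) =
      ((contract3 (fun a b c => p (a, b, c)) x).submatrix ρ γ).det := by
  have e : ∀ f : MvPolynomial (Fin k) (MvPolynomial (Fin k × Fin m × Fin n) F),
      eval x (specialize p f) = ((eval x).comp (MvPolynomial.map (eval p))) f := fun _ => rfl
  rw [e, RingHom.map_det]
  congr 1
  ext i j
  simp [contract3, Matrix.submatrix_apply, map_sum, MvPolynomial.map_X, MvPolynomial.map_C,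
    MvPolynomial.eval_X, MvPolynomial.eval_C]

end Minors

/-- **The set of (points of) tensors of minrank at most `r` is closed in the Zariski topology of
`U ⊗ V ⊗ W`** (`F` algebraically closed): it is the locus of parameters `T` at which the
`(r+1) × (r+1)` minors of the generic contraction — forms of degree `r+1` in `x` — have a common
zero `x ≠ 0`, closed by the main theorem of elimination theory
(`isClosed_setOf_exists_common_zero_set`). [cite: BlaserIkenmeyerLysikovPandeySchreyer2019, Thm. 14] -/
theorem isClosed_image_minrankSet [IsAlgClosed F] (k m n r : ℕ) :
    IsClosed[zariskiTopologyPi (Fin k × Fin m × Fin n) F]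
      (trilinearPt '' (minrankSet F r : Set (Fin k → Fin m → Fin n → F))) := by
  classical
  -- the generic contraction and the set of its `(r+1)`-minors
  set G : Matrix (Fin m) (Fin n) (MvPolynomial (Fin k) (MvPolynomial (Fin k × Fin m × Fin n) F)) :=
    Matrix.of fun (b : Fin m) (c : Fin n) =>
      ∑ a : Fin k, (X a : MvPolynomial (Fin k) (MvPolynomial (Fin k × Fin m × Fin n) F)) *
        C (X (a, b, c)) with hG
  let S : Set (MvPolynomial (Fin k) (MvPolynomial (Fin k × Fin m × Fin n) F)) :=
    Set.range fun ργ : (Fin (r + 1) → Fin m) × (Fin (r + 1) → Fin n) =>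
      (G.submatrix ργ.1 ργ.2).det
  have hS : ∀ f ∈ S, ∃ d, f.IsHomogeneous d := by
    rintro _ ⟨⟨ρ, γ⟩, rfl⟩
    refine ⟨Fintype.card (Fin (r + 1)), isHomogeneous_det_of_forall_isHomogeneous_one ?_⟩
    intro i j
    rw [Matrix.submatrix_apply, hG, Matrix.of_apply]
    exact genericContract_isHomogeneous F k m n _ _
  have hcl := isClosed_setOf_exists_common_zero_set (k := F) (ι := Fin k)
    (σ := Fin k × Fin m × Fin n) (S := S) hS
  convert hcl using 1
  ext p
  simp only [Set.mem_image, Set.mem_setOf_eq]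
  constructor
  · rintro ⟨T, ⟨x, hx0, hr⟩, rfl⟩
    refine ⟨x, hx0, ?_⟩
    rintro _ ⟨⟨ρ, γ⟩, rfl⟩
    rw [hG, eval_specialize_det_submatrix]
    exact (Literature.LinearAlgebra.Matrix.rank_le_iff_det_submatrix_eq_zero _).1 hr ρ γ
  · rintro ⟨x, hx0, hx⟩
    refine ⟨fun a b c => p (a, b, c), ⟨x, hx0, ?_⟩, rfl⟩
    refine (Literature.LinearAlgebra.Matrix.rank_le_iff_det_submatrix_eq_zero _).2 fun ρ γ => ?_
    have h := hx _ ⟨⟨ρ, γ⟩, rfl⟩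
    rwa [hG, eval_specialize_det_submatrix] at h

/-! ### The same over arbitrary finite index types

The typed fact `BILPS2019_thm14` indexes `U, V, W` by `Fin k, Fin m, Fin n`; Thm 19 / Cor 20 of the
source (typed `BILPS2019_thm19`, `BILPS2019_cor20`) live on `U = F^{Option (Fin k')}`,
`L = F^{BIdx k' n r}`. The proof above uses nothing about `Fin`, so we record Thm 14 for arbitrary
finite index types `ι, κ, μ` (same argument, verbatim). -/

section Fintype

variable {ι κ μ : Type*} [Fintype ι]

variable (F) in
/-- The generic contraction `∑ₐ Xₐ T_{abc}` over arbitrary finite index types is a matrix of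
linear forms in `x`. [cite: BlaserIkenmeyerLysikovPandeySchreyer2019, Thm. 14 (proof)] -/
theorem isHomogeneous_genericContract (b : κ) (c : μ) :
    (∑ a : ι, (X a : MvPolynomial ι (MvPolynomial (ι × κ × μ) F)) * C (X (a, b, c))).IsHomogeneous
      1 := by
  refine IsHomogeneous.sum _ _ _ fun a _ => ?_
  simpa using (isHomogeneous_X _ a).mul (isHomogeneous_C ι (X (a, b, c) :
    MvPolynomial (ι × κ × μ) F))

/-- Specialisation at `T` and evaluation at `x` of a minor of the generic contraction is the
corresponding minor of `Tx` (arbitrary finite index types).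
[cite: BlaserIkenmeyerLysikovPandeySchreyer2019, Thm. 14 (proof)] -/
theorem eval_specialize_det_genericContract_submatrix {s : ℕ} (ρ : Fin s → κ) (γ : Fin s → μ)
    (p : ι × κ × μ → F) (x : ι → F) :
    eval x (specialize p
      ((Matrix.of fun (b : κ) (c : μ) =>
          ∑ a : ι, (X a : MvPolynomial ι (MvPolynomial (ι × κ × μ) F)) *
            C (X (a, b, c))).submatrix ρ γ).det) =
      ((contract3 (fun a b c => p (a, b, c)) x).submatrix ρ γ).det := by
  have e : ∀ f : MvPolynomial ι (MvPolynomial (ι × κ × μ) F),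
      eval x (specialize p f) = ((eval x).comp (MvPolynomial.map (eval p))) f := fun _ => rfl
  rw [e, RingHom.map_det]
  congr 1
  ext i j
  simp [contract3, Matrix.submatrix_apply, map_sum, MvPolynomial.map_X, MvPolynomial.map_C,
    MvPolynomial.eval_X, MvPolynomial.eval_C]

variable [DecidableEq ι] [Fintype κ] [Fintype μ]

/-- **Thm 14 over arbitrary finite index types, topological form**: the points of the minrank
variety `𝓜_r ⊆ F^ι ⊗ F^κ ⊗ F^μ` form a closed subset of affine space in the Zariski topology
(`F` algebraically closed). [cite: BlaserIkenmeyerLysikovPandeySchreyer2019, Thm. 14] -/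
theorem isClosed_trilinearPt_image_minrankSet [IsAlgClosed F] (r : ℕ) :
    IsClosed[zariskiTopologyPi (ι × κ × μ) F]
      (trilinearPt '' (minrankSet F r : Set (ι → κ → μ → F))) := by
  classical
  set G : Matrix κ μ (MvPolynomial ι (MvPolynomial (ι × κ × μ) F)) :=
    Matrix.of fun (b : κ) (c : μ) =>
      ∑ a : ι, (X a : MvPolynomial ι (MvPolynomial (ι × κ × μ) F)) * C (X (a, b, c)) with hG
  let S : Set (MvPolynomial ι (MvPolynomial (ι × κ × μ) F)) :=
    Set.range fun ργ : (Fin (r + 1) → κ) × (Fin (r + 1) → μ) => (G.submatrix ργ.1 ργ.2).det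
  have hS : ∀ f ∈ S, ∃ d, f.IsHomogeneous d := by
    rintro _ ⟨⟨ρ, γ⟩, rfl⟩
    refine ⟨Fintype.card (Fin (r + 1)), isHomogeneous_det_of_forall_isHomogeneous_one ?_⟩
    intro i j
    rw [Matrix.submatrix_apply, hG, Matrix.of_apply]
    exact isHomogeneous_genericContract F _ _
  have hcl := isClosed_setOf_exists_common_zero_set (k := F) (ι := ι) (σ := ι × κ × μ)
    (S := S) hS
  convert hcl using 1
  ext p
  simp only [Set.mem_image, Set.mem_setOf_eq]
  constructor
  · rintro ⟨T, ⟨x, hx0, hr⟩, rfl⟩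
    refine ⟨x, hx0, ?_⟩
    rintro _ ⟨⟨ρ, γ⟩, rfl⟩
    rw [hG, eval_specialize_det_genericContract_submatrix]
    exact (Literature.LinearAlgebra.Matrix.rank_le_iff_det_submatrix_eq_zero _).1 hr ρ γ
  · rintro ⟨x, hx0, hx⟩
    refine ⟨fun a b c => p (a, b, c), ⟨x, hx0, ?_⟩, rfl⟩
    refine (Literature.LinearAlgebra.Matrix.rank_le_iff_det_submatrix_eq_zero _).2 fun ρ γ => ?_
    have h := hx _ ⟨⟨ρ, γ⟩, rfl⟩
    rwa [hG, eval_specialize_det_genericContract_submatrix] at h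

/-- **Thm 14 over arbitrary finite index types**: the Zariski closure of (the points of) `𝓜_r`
is `𝓜_r`, for tensors `ι → κ → μ → F` over an algebraically closed field — the form of Thm 14
used by Thm 19 / Cor 20 (`U = F^{Option (Fin k')}`, `V = W = L = F^{BIdx k' n r}`).
[cite: BlaserIkenmeyerLysikovPandeySchreyer2019, Thm. 14] -/
theorem zariskiClosure_trilinearPt_image_minrankSet [IsAlgClosed F] (r : ℕ) :
    zariskiClosure (trilinearPt '' (minrankSet F r : Set (ι → κ → μ → F))) =
      trilinearPt '' (minrankSet F r : Set (ι → κ → μ → F)) :=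
  zariskiClosure_eq_self_of_isClosed (isClosed_trilinearPt_image_minrankSet (F := F) r)

/-- Hence, over an algebraically closed field, **a Zariski closure lies in `𝓜_r` as soon as the
set does** (e.g. the orbit closure of a tensor of minrank `≤ r`, given the invariance Lemma 18 —
the first half of the printed proof of Thm 19). [cite: BlaserIkenmeyerLysikovPandeySchreyer2019, Thm. 19 (proof)] -/
theorem zariskiClosure_subset_image_minrankSet [IsAlgClosed F] {r : ℕ} {S : Set (ι × κ × μ → F)}
    (hS : S ⊆ trilinearPt '' (minrankSet F r : Set (ι → κ → μ → F))) :
    zariskiClosure S ⊆ trilinearPt '' (minrankSet F r : Set (ι → κ → μ → F)) := by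
  rw [← zariskiClosure_trilinearPt_image_minrankSet (F := F) r]
  exact zariskiClosure_mono hS

end Fintype

end BILPS2019Thm14

/-- **BILPS Thm 14** [BlaserIkenmeyerLysikovPandeySchreyer2019, Thm 14]: over an algebraically
closed field the set of tensors `T ∈ U ⊗ V ⊗ W` of minrank at most `r` is Zariski closed — the
named fact `BILPS2019_thm14` (the Zariski closure of the points of `𝓜_r` is `𝓜_r`) is a theorem.
Proof as printed (projection of the incidence variety from `ℙU*`, main theorem of elimination
theory), through `BILPS2019Thm14.isClosed_image_minrankSet`.
[cite: BlaserIkenmeyerLysikovPandeySchreyer2019, Thm. 14] -/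
theorem BILPS2019_thm14_holds : BILPS2019_thm14 := by
  intro F _ _ k m n r
  exact BILPS2019Thm14.zariskiClosure_eq_self_of_isClosed
    (BILPS2019Thm14.isClosed_image_minrankSet (F := F) k m n r)

end Literature.Computability.AlgebraicComplexity
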